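import Literature.Probability.NegativeDependence.AlmostExchangeableRayleigh
import Literature.Probability.NegativeDependence.TruncationStochasticDomination
import Literature.Probability.NegativeDependence.RayleighTranslationDilution
import HarnessLib

/-!
# A Rayleigh measure on `2^[20]` that is not ULC and whose truncations `μ_3 ⋠ μ_4`
# (Borcea–Brändén–Liggett §7, Counterexamples 1 and 2 — the Rayleigh parts)

J. Borcea, P. Brändén, T. M. Liggett, *Negative dependence and the geometry of polynomials*, J. Amer. Math. Soc.
22 (2009) 521–567 (arXiv:0707.2340, held `paper:arxiv-0707.2340`), §2.1 and §7. Verbatim: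

> **Conjecture 2.4.** Any Rayleigh measure `μ ∈ 𝔓_n` is ULC. [Wagner's "Big Conjecture"]
> (§7, Counterexample 1.) Suppose that `μ` is a probability measure on `2^[n+1]` whose generating polynomial
> `f(z_1,…,z_{n+1}) = z_{n+1} Σ_{k=0}^n a_k e_k(z_1,…,z_n) + Σ_{k=0}^n b_k e_k(z_1,…,z_n)` is symmetric in its
> first `n` variables. […] Set `a_0 = 2t², a_1 = 2t, a_2 = 4/9 - t, a_3 = 2/3, a_4 = 1, a_5 = (2/3)t`,
> `b_0 = 9t³, b_1 = 9t², b_2 = 3t, b_3 = 1, b_4 = 3, b_5 = 9 - t`. For `t` sufficiently small and positive […]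
> `(λa_1+b_1)² - (λa_0+b_0)(λa_2+b_2) = t²(2λ+9t)[(14/9+t)λ+6t] ≥ 0`, […] for any `λ ≥ 0` if e.g. `0 < t ≤ 1/20`.
> Moreover, `a_0b_1 - a_1b_0 = 0`, `a_1b_2 - a_2b_1 = t²(2+9t) ≥ 0`, […] By taking e.g. `t = 10^{-4}` one can then
> check that the corresponding sequences `{a_k}_{k=0}^m` and `{b_k/m}_{k=0}^m` constructed in (7.1) produce a
> counterexample to Problem 7.1 for any integer `m ≥ 19`. Therefore, both Conjecture 2.4 and Conjecture 2.5 fail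
> whenever the (total) number of variables satisfies `n+1 ≥ 20`.
> (§7, Counterexample 2.) Let `f` […] be the `n+1 = 20` variable polynomial in the previous counterexample and
> let `μ` be the corresponding probability measure […]. For `𝒜 = {S ∈ 2^[n+1] : n+1 ∈ S}` we have
> `μ_k(𝒜) = a_{k-1} C(n,k-1) / (a_{k-1} C(n,k-1) + b_k C(n,k))` […]. Hence `μ_k(𝒜) ≤ μ_{k+1}(𝒜)` ⟺ […]. This
> fails for `k = 3` and `0 < t < 1/18`. □

## What is here

With `t = 10^{-4}`, `m = n = 19` (so `n + 1 = 20` variables, indexed by `Option (Fin 19)`), the profiles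
`a = ceA`, `b/m = ceB'` and the weight `ceWeight = almostExch ceA ceB'`:

* `ceWeight` is nonnegative with positive mass and **Rayleigh** (`isRayleigh_ceWeight`, by Prop. 6.2 — tree
  `isRayleigh_almostExch` — from the printed inequalities, checked here by `norm_num`/`nlinarith` at `t = 10^{-4}`);
* its rank sequence is `r_k = C(19,k-1) a_{k-1} + C(19,k) b_k/19` (`rankSeq_almostExch`) and violates ultra
  log-concavity at `k = 4`: **`not_isUltraLogConcave_rankSeq_ceWeight`** — so **Conjecture 2.4 fails**
  (`BorceaBrandenLiggett_counterexample_1`: a Rayleigh probability measure on `2^[20]` that is not ULC);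
* Counterexample 2 for the same (Rayleigh, hence h-NLC+) measure: the truncations satisfy `μ_3(𝒜) > μ_4(𝒜)` for the
  increasing event `𝒜 = {S ∋ z_{20}}`, so **`μ_3 ⋠ μ_4`** (`BorceaBrandenLiggett_counterexample_2`, tree `StochDom`,
  `truncMeasure`).

The CNA+ assertions of §7 (Conjectures 2.3, 2.5, 2.9 as printed, via Thm. 6.5) are NOT treated here.
Tools: `isLogConcaveSeq_of_pos_of_sq` (LC from the three-term inequalities for a positive finitely supported
sequence), `rankSeq_almostExch`, `sum_card_none_mem_almostExch`.

## References

* [BorceaBrandenLiggett2007] J. Borcea, P. Brändén, T. M. Liggett, Negative dependence and the geometry of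
  polynomials, J. Amer. Math. Soc. 22 (2009); arXiv:0707.2340 — §2.1 Conj. 2.4, Def. 2.8, Def. 2.14–2.15; §6
  Prop. 6.2; §7 Counterexamples 1, 2.
* [Wagner2008] D. G. Wagner, Negatively correlated random variables and Mason's conjecture …, Ann. Comb. 12
  (2008) — Conj. 3.4 ("the Big Conjecture").
* [Pemantle2000] R. Pemantle, Towards a theory of negative dependence — Conjecture 4, Question 10.
-/

noncomputable section

open Finset MvPolynomial
open Literature.Probability.Distributions
open Literature.Probability.MarkovChains (StochDom lawMean)
open Literature.Combinatorics.LorentzianPolynomials (IsUltraLogConcave)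

namespace Literature.Probability.NegativeDependence

/-! ## §1 Log-concavity from the three-term inequalities -/

section ThreeTerm

/-- **LC (Def. 2.8) from the three-term inequalities**: a sequence positive on `[0, N]`, zero above `N`, with
`f_n f_{n+2} ≤ f_{n+1}²` is log-concave with no internal zeros (`PF₂`). [cite: BorceaBrandenLiggett2007, §2.1
Def. 2.8 ("log-concave … no internal zeros"); Karlin1968, Ch. 8 §1] -/
theorem isLogConcaveSeq_of_pos_of_sq {f : ℕ → ℝ} (N : ℕ) (hpos : ∀ n, n ≤ N → 0 < f n)
    (hzero : ∀ n, N < n → f n = 0) (hlc : ∀ n, n + 2 ≤ N → f n * f (n + 2) ≤ f (n + 1) * f (n + 1)) :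
    IsLogConcaveSeq f := by
  have h0 : ∀ n, 0 ≤ f n := fun n => by
    by_cases h : n ≤ N
    · exact (hpos n h).le
    · exact (hzero n (not_le.1 h)).ge
  -- the ratios `f_{n+1}/f_n` decrease: `f_i f_{j+1} ≤ f_{i+1} f_j` for `i ≤ j < N`
  have ratio : ∀ e i, i + e + 1 ≤ N → f i * f (i + e + 1) ≤ f (i + 1) * f (i + e) := by
    intro e
    induction e with
    | zero => intro i _; simp only [Nat.add_zero, mul_comm, le_refl]
    | succ e ih =>
      intro i hiN
      have ih' := ih i (by omega)
      have hl := hlc (i + e) (by omega)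
      have hp1 := hpos (i + e) (by omega)
      have hp2 := hpos (i + e + 1) (by omega)
      have h3 : f i * f (i + (e + 1) + 1) * (f (i + e) * f (i + e + 1)) ≤
          f (i + 1) * f (i + (e + 1)) * (f (i + e) * f (i + e + 1)) := by
        calc f i * f (i + (e + 1) + 1) * (f (i + e) * f (i + e + 1))
            = (f i * f (i + e + 1)) * (f (i + e) * f (i + e + 2)) := by ring_nf
          _ ≤ (f (i + 1) * f (i + e)) * (f (i + e + 1) * f (i + e + 1)) :=
              mul_le_mul ih' hl (mul_nonneg (h0 _) (h0 _)) (mul_nonneg (h0 _) (h0 _))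
          _ = f (i + 1) * f (i + (e + 1)) * (f (i + e) * f (i + e + 1)) := by ring_nf
      exact le_of_mul_le_mul_right h3 (mul_pos hp1 hp2)
  -- `P(δ)`: `f a f (c+δ) ≤ f (a+δ) f c` for `a ≤ c`, `c + δ ≤ N`
  have main : ∀ δ a c, a ≤ c → c + δ ≤ N → f a * f (c + δ) ≤ f (a + δ) * f c := by
    intro δ
    induction δ with
    | zero => intro a c _ _; rw [Nat.add_zero, Nat.add_zero]
    | succ δ ih =>
      intro a c hac hcN
      have ih' := ih a c hac (by omega)
      have hr := ratio (c - a) (a + δ) (by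
        have : a + δ + (c - a) + 1 = c + δ + 1 := by omega
        rw [this]; exact hcN)
      have heq1 : a + δ + (c - a) + 1 = c + (δ + 1) := by omega
      have heq2 : a + δ + (c - a) = c + δ := by omega
      rw [heq1, heq2] at hr
      -- `hr : f (a+δ) f (c+δ+1) ≤ f (a+δ+1) f (c+δ)`; cancel `f (a+δ) f (c+δ) > 0`
      have hp1 := hpos (a + δ) (by omega)
      have hp2 := hpos (c + δ) (by omega)
      have h3 : f a * f (c + (δ + 1)) * (f (a + δ) * f (c + δ)) ≤
          f (a + (δ + 1)) * f c * (f (a + δ) * f (c + δ)) := by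
        calc f a * f (c + (δ + 1)) * (f (a + δ) * f (c + δ))
            = (f a * f (c + δ)) * (f (a + δ) * f (c + (δ + 1))) := by ring
          _ ≤ (f (a + δ) * f c) * (f (a + δ + 1) * f (c + δ)) :=
              mul_le_mul ih' hr (mul_nonneg (h0 _) (h0 _)) (mul_nonneg (h0 _) (h0 _))
          _ = f (a + (δ + 1)) * f c * (f (a + δ) * f (c + δ)) := by rw [Nat.add_assoc]; ring
      exact le_of_mul_le_mul_right h3 (mul_pos hp1 hp2)
  refine ⟨h0, fun a b c d hab hbd h => ?_⟩
  by_cases hd : d ≤ N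
  · have key := main (b - a) a c (by omega) (by rw [show c + (b - a) = d by omega]; exact hd)
    rwa [show c + (b - a) = d by omega, show a + (b - a) = b by omega] at key
  · rw [hzero d (not_le.1 hd), mul_zero]
    exact mul_nonneg (h0 b) (h0 c)

end ThreeTerm

/-! ## §2 Rank sequences of almost exchangeable weights -/

section Rank

variable {τ : Type*} [Fintype τ] [DecidableEq τ]

/-- `Σ_{|U| = k, ∗ ∈ U} μ(U) = C(n,k-1) a_{k-1}` for the almost exchangeable weight (`0` for `k = 0`).
[cite: BorceaBrandenLiggett2007, §7 Counterexample 2 ("`μ_k(𝒜) = a_{k-1} C(n,k-1) / …`")] -/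
theorem sum_card_none_mem_almostExch (a b : ℕ → ℝ) (k : ℕ) :
    (∑ U : Finset (Option τ), if U.card = k ∧ none ∈ U then almostExch a b U else 0) =
      if k = 0 then 0 else ((Fintype.card τ).choose (k - 1) : ℝ) * a (k - 1) := by
  rw [sum_finset_option]
  have hnone : ∀ S : Finset τ, (none : Option τ) ∉ S.map Function.Embedding.some := fun S h => by
    obtain ⟨y, _, hy⟩ := Finset.mem_map.1 h
    exact Option.some_ne_none y hy
  have h1 : ∀ S : Finset τ, (if (S.map Function.Embedding.some).card = k ∧ none ∈ S.map Function.Embedding.some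
      then almostExch a b (S.map Function.Embedding.some) else 0) = 0 := fun S => by
    rw [if_neg (fun h => hnone S h.2)]
  simp only [h1, zero_add]
  have h2 : ∀ S : Finset τ, (if (insert none (S.map Function.Embedding.some)).card = k ∧
      none ∈ insert none (S.map Function.Embedding.some) then
      almostExch a b (insert none (S.map Function.Embedding.some)) else 0) =
      if S.card + 1 = k then a S.card else 0 := fun S => by
    rw [Finset.card_insert_of_notMem (hnone S), Finset.card_map, almostExch_apply, if_pos (Finset.mem_insert_self _ _),
      eraseNone_insert_none, Finset.eraseNone_map_some]
    by_cases h : S.card + 1 = k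
    · rw [if_pos ⟨h, Finset.mem_insert_self _ _⟩, if_pos h]
    · rw [if_neg (fun h' => h h'.1), if_neg h]
  simp only [h2]
  by_cases hk : k = 0
  · rw [if_pos hk]
    exact Finset.sum_eq_zero fun S _ => by rw [if_neg (by omega)]
  · rw [if_neg hk]
    have h3 : ∀ S : Finset τ, (if S.card + 1 = k then a S.card else 0) = if S.card = k - 1 then a S.card else 0 :=
      fun S => by
        by_cases h : S.card + 1 = k
        · rw [if_pos h, if_pos (by omega)]
        · rw [if_neg h, if_neg (by omega)]
    simp only [h3]
    rw [← Finset.sum_filter]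
    have hfilt : Finset.univ.filter (fun S : Finset τ => S.card = k - 1) = powersetCard (k - 1) Finset.univ := by
      ext S; rw [Finset.mem_filter, Finset.mem_powersetCard_univ]; simp
    rw [hfilt, ← rankSeq_def (fun S : Finset τ => a S.card), rankSeq_card]

/-- `Σ_{|U| = k, ∗ ∉ U} μ(U) = C(n,k) b_k` for the almost exchangeable weight. [cite: BorceaBrandenLiggett2007, §7
Counterexample 2 ("`… + b_k C(n,k)`")] -/
theorem sum_card_none_not_mem_almostExch (a b : ℕ → ℝ) (k : ℕ) :
    (∑ U : Finset (Option τ), if U.card = k ∧ none ∉ U then almostExch a b U else 0) =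
      ((Fintype.card τ).choose k : ℝ) * b k := by
  rw [sum_finset_option]
  have hnone : ∀ S : Finset τ, (none : Option τ) ∉ S.map Function.Embedding.some := fun S h => by
    obtain ⟨y, _, hy⟩ := Finset.mem_map.1 h
    exact Option.some_ne_none y hy
  have h1 : ∀ S : Finset τ, (if (insert none (S.map Function.Embedding.some)).card = k ∧
      none ∉ insert none (S.map Function.Embedding.some) then
      almostExch a b (insert none (S.map Function.Embedding.some)) else 0) = 0 := fun S => by
    rw [if_neg (fun h => h.2 (Finset.mem_insert_self _ _))]
  have h2 : ∀ S : Finset τ, (if (S.map Function.Embedding.some).card = k ∧ none ∉ S.map Function.Embedding.some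
      then almostExch a b (S.map Function.Embedding.some) else 0) = if S.card = k then b S.card else 0 := fun S => by
    rw [Finset.card_map, almostExch_apply, if_neg (hnone S), Finset.eraseNone_map_some]
    by_cases h : S.card = k
    · rw [if_pos ⟨h, hnone S⟩, if_pos h]
    · rw [if_neg (fun h' => h h'.1), if_neg h]
  simp only [h1, h2, add_zero]
  rw [← Finset.sum_filter]
  have hfilt : Finset.univ.filter (fun S : Finset τ => S.card = k) = powersetCard k Finset.univ := by
    ext S; rw [Finset.mem_filter, Finset.mem_powersetCard_univ]; simp
  rw [hfilt, ← rankSeq_def (fun S : Finset τ => b S.card), rankSeq_card]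

/-- **The rank sequence of the almost exchangeable weight**: `r_k = C(n,k-1) a_{k-1} + C(n,k) b_k`.
[cite: BorceaBrandenLiggett2007, §7 Counterexample 1 ("`Δ(f)(t) = Σ [C(n,k-1) a_{k-1} + C(n,k) b_k] t^k`")] -/
theorem rankSeq_almostExch (a b : ℕ → ℝ) (k : ℕ) :
    rankSeq (almostExch a b : Finset (Option τ) → ℝ) k =
      (if k = 0 then 0 else ((Fintype.card τ).choose (k - 1) : ℝ) * a (k - 1)) + ((Fintype.card τ).choose k : ℝ) * b k := by
  rw [← sum_card_none_mem_almostExch a b k, ← sum_card_none_not_mem_almostExch a b k, ← Finset.sum_add_distrib,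
    rankSeq_def]
  rw [show powersetCard k (Finset.univ : Finset (Option τ)) =
      Finset.univ.filter (fun U : Finset (Option τ) => U.card = k) by
    ext U; rw [Finset.mem_filter, Finset.mem_powersetCard_univ]; simp, Finset.sum_filter]
  refine Finset.sum_congr rfl fun U _ => ?_
  by_cases hU : U.card = k <;> by_cases hn : none ∈ U <;> simp [hU, hn]

/-- The mass of the single-level truncation is the rank-sequence entry. [cite: BorceaBrandenLiggett2007, §2.4
Def. 2.15] -/
theorem mass_truncW_self {σ : Type*} [Fintype σ] (μ : Finset σ → ℝ) (k : ℕ) : mass (truncW k k μ) = rankSeq μ k := by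
  rw [mass, rankSeq_def, show powersetCard k (Finset.univ : Finset σ) =
      Finset.univ.filter (fun U : Finset σ => U.card = k) by
    ext U; rw [Finset.mem_filter, Finset.mem_powersetCard_univ]; simp, Finset.sum_filter]
  refine Finset.sum_congr rfl fun S _ => ?_
  rw [truncW_apply]
  by_cases h : S.card = k
  · rw [if_pos ⟨h.ge, h.le⟩, if_pos h]
  · rw [if_neg (fun h' => h (le_antisymm h'.2 h'.1)), if_neg h]

end Rank

/-! ## §3 The sequences of Counterexample 1 at `t = 10⁻⁴`, `m = 19` -/

section Sequences

/-- `a_0,…,a_5 = 2t², 2t, 4/9 - t, 2/3, 1, (2/3)t` at `t = 10⁻⁴` (zero beyond).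
[cite: BorceaBrandenLiggett2007, §7 Counterexample 1] -/
def ceA : ℕ → ℝ
  | 0 => 2 * (1 / 10000) ^ 2
  | 1 => 2 * (1 / 10000)
  | 2 => 4 / 9 - 1 / 10000
  | 3 => 2 / 3
  | 4 => 1
  | 5 => 2 / 3 * (1 / 10000)
  | _ => 0

/-- `b_0,…,b_5 = 9t³, 9t², 3t, 1, 3, 9 - t` at `t = 10⁻⁴`, divided by `m = 19` (zero beyond) — the sequence
`{b_k/m}` of (7.1). [cite: BorceaBrandenLiggett2007, §7 Counterexample 1 (the sequences `{a_k}` and `{b_k/m}`)] -/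
def ceB' : ℕ → ℝ
  | 0 => 9 * (1 / 10000) ^ 3 / 19
  | 1 => 9 * (1 / 10000) ^ 2 / 19
  | 2 => 3 * (1 / 10000) / 19
  | 3 => 1 / 19
  | 4 => 3 / 19
  | 5 => (9 - 1 / 10000) / 19
  | _ => 0

/-- The values, for `simp`. [cite: BorceaBrandenLiggett2007, §7 Counterexample 1] -/
theorem ceA_values : ceA 0 = 2 * (1 / 10000) ^ 2 ∧ ceA 1 = 2 * (1 / 10000) ∧ ceA 2 = 4 / 9 - 1 / 10000 ∧
    ceA 3 = 2 / 3 ∧ ceA 4 = 1 ∧ ceA 5 = 2 / 3 * (1 / 10000) ∧ ∀ k, 6 ≤ k → ceA k = 0 := by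
  refine ⟨rfl, rfl, rfl, rfl, rfl, rfl, fun k hk => ?_⟩
  match k, hk with
  | k + 6, _ => rfl

/-- The values, for `simp`. [cite: BorceaBrandenLiggett2007, §7 Counterexample 1] -/
theorem ceB'_values : ceB' 0 = 9 * (1 / 10000) ^ 3 / 19 ∧ ceB' 1 = 9 * (1 / 10000) ^ 2 / 19 ∧
    ceB' 2 = 3 * (1 / 10000) / 19 ∧ ceB' 3 = 1 / 19 ∧ ceB' 4 = 3 / 19 ∧ ceB' 5 = (9 - 1 / 10000) / 19 ∧
    ∀ k, 6 ≤ k → ceB' k = 0 := by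
  refine ⟨rfl, rfl, rfl, rfl, rfl, rfl, fun k hk => ?_⟩
  match k, hk with
  | k + 6, _ => rfl

/-- `a` vanishes above `5`, in particular above `m = 19`. [cite: BorceaBrandenLiggett2007, §7 Counterexample 1] -/
theorem ceA_eq_zero {k : ℕ} (hk : 6 ≤ k) : ceA k = 0 := ceA_values.2.2.2.2.2.2 k hk

/-- `b/m` vanishes above `5`. [cite: BorceaBrandenLiggett2007, §7 Counterexample 1] -/
theorem ceB'_eq_zero {k : ℕ} (hk : 6 ≤ k) : ceB' k = 0 := ceB'_values.2.2.2.2.2.2 k hk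

/-- `a_k ≥ 0`. [cite: BorceaBrandenLiggett2007, §7 Counterexample 1 ("both sequences … are positive")] -/
theorem ceA_nonneg (k : ℕ) : 0 ≤ ceA k := by
  match k with
  | 0 | 1 | 2 | 3 | 4 | 5 => simp only [ceA]; norm_num
  | k + 6 => exact (ceA_eq_zero (by omega)).ge

/-- `b_k/m ≥ 0`. [cite: BorceaBrandenLiggett2007, §7 Counterexample 1] -/
theorem ceB'_nonneg (k : ℕ) : 0 ≤ ceB' k := by
  match k with
  | 0 | 1 | 2 | 3 | 4 | 5 => simp only [ceB']; norm_num
  | k + 6 => exact (ceB'_eq_zero (by omega)).ge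

/-- **Condition (1) of Problem 7.2 / (i) of Prop. 6.2**: `{λ a_k + b_k/m}` is LC for every `λ ≥ 0` (the four
displayed inequalities, at `t = 10⁻⁴`). [cite: BorceaBrandenLiggett2007, §7 Counterexample 1 ("for any `λ ≥ 0`
if e.g. `0 < t ≤ 1/20`")] -/
theorem isLogConcaveSeq_ceA_ceB' {l : ℝ} (hl : 0 ≤ l) : IsLogConcaveSeq fun k => l * ceA k + ceB' k := by
  refine isLogConcaveSeq_of_pos_of_sq 5 (fun n hn => ?_) (fun n hn => ?_) (fun n hn => ?_)
  · have hb : 0 < ceB' n := by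
      match n, hn with
      | 0, _ | 1, _ | 2, _ | 3, _ | 4, _ | 5, _ => simp only [ceB']; norm_num
    exact add_pos_of_nonneg_of_pos (mul_nonneg hl (ceA_nonneg n)) hb
  · rw [ceA_eq_zero (by omega), ceB'_eq_zero (by omega), mul_zero, add_zero]
  · match n, hn with
    | 0, _ => simp only [ceA, ceB']; nlinarith [mul_nonneg hl hl, hl]
    | 1, _ => simp only [ceA, ceB']; nlinarith [mul_nonneg hl hl, hl]
    | 2, _ => simp only [ceA, ceB']; nlinarith [mul_nonneg hl hl, hl]
    | 3, _ => simp only [ceA, ceB']; nlinarith [mul_nonneg hl hl, hl]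

/-- `{a_k}` itself is LC (the case `θ = 1` of (i)). [cite: BorceaBrandenLiggett2007, §7 Counterexample 1] -/
theorem isLogConcaveSeq_ceA : IsLogConcaveSeq ceA := by
  refine isLogConcaveSeq_of_pos_of_sq 5 (fun n hn => ?_) (fun n hn => ceA_eq_zero (by omega)) (fun n hn => ?_)
  · match n, hn with
    | 0, _ | 1, _ | 2, _ | 3, _ | 4, _ | 5, _ => simp only [ceA]; norm_num
  · match n, hn with
    | 0, _ | 1, _ | 2, _ | 3, _ => simp only [ceA]; norm_num

/-- **(i) of Prop. 6.2** for `(a, b/m)`: `{θ a_k + (1-θ) b_k/m}` is LC for every `θ ∈ [0,1]`.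
[cite: BorceaBrandenLiggett2007, §7 Counterexample 1 (conditions (1) in Problems 7.1/7.2)] -/
theorem condition_i_ce {θ : ℝ} (h0 : 0 ≤ θ) (h1 : θ ≤ 1) :
    IsLogConcaveSeq fun k => θ * ceA k + (1 - θ) * ceB' k := by
  rcases h1.lt_or_eq with h1' | rfl
  · have h1θ : 0 < 1 - θ := by linarith
    have key := (isLogConcaveSeq_ceA_ceB' (l := θ / (1 - θ)) (div_nonneg h0 h1θ.le)).const_mul h1θ.le
    have heq : (fun k => (1 - θ) * (θ / (1 - θ) * ceA k + ceB' k)) = fun k => θ * ceA k + (1 - θ) * ceB' k := by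
      funext k; field_simp
    rwa [heq] at key
  · have heq : (fun k => (1 : ℝ) * ceA k + (1 - 1) * ceB' k) = ceA := by funext k; ring
    rw [heq]; exact isLogConcaveSeq_ceA

/-- **(ii) of Prop. 6.2 / condition (2) of Problem 7.2**: `a_k b_{k+1} ≥ a_{k+1} b_k` ("`a_0b_1 - a_1b_0 = 0`,
`a_1b_2 - a_2b_1 = t²(2+9t) ≥ 0`, `a_2b_3 - a_3b_2 = 4/9 - 3t ≥ 0`, `a_3b_4 - a_4b_3 = 1`, `a_4b_5 - a_5b_4 = 9 - 3t ≥ 0`").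
[cite: BorceaBrandenLiggett2007, §7 Counterexample 1] -/
theorem condition_ii_ce (k : ℕ) : ceA (k + 1) * ceB' k ≤ ceA k * ceB' (k + 1) := by
  match k with
  | 0 | 1 | 2 | 3 | 4 => simp only [ceA, ceB']; norm_num
  | k + 5 => rw [ceA_eq_zero (by omega), zero_mul]; exact mul_nonneg (ceA_nonneg _) (ceB'_nonneg _)

end Sequences

/-! ## §4 The measure on `2^[20]` and Counterexamples 1–2 -/

section Counterexample

/-- **The weight of Counterexample 1**: `z_{20} Σ_k a_k e_k(z_1,…,z_{19}) + Σ_k (b_k/19) e_k(z_1,…,z_{19})`, on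
`2^{Option (Fin 19)}` with `z_{20}` = `none`. [cite: BorceaBrandenLiggett2007, §7 Counterexample 1 (`m = 19`,
`t = 10⁻⁴`)] -/
def ceWeight : Finset (Option (Fin 19)) → ℝ := almostExch ceA ceB'

/-- The weight is nonnegative. [cite: BorceaBrandenLiggett2007, §7 Counterexample 1] -/
theorem ceWeight_nonneg (U : Finset (Option (Fin 19))) : 0 ≤ ceWeight U := almostExch_nonneg ceA_nonneg ceB'_nonneg U

/-- **The weight of Counterexample 1 is Rayleigh** (Prop. 6.2 with (i), (ii)). [cite: BorceaBrandenLiggett2007,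
§7 Counterexample 1; §6 Prop. 6.2] -/
theorem isRayleigh_ceWeight : IsRayleigh ceWeight :=
  isRayleigh_almostExch (fun _ h0 h1 => condition_i_ce h0 h1) condition_ii_ce

/-- Its rank sequence at `k = 3, 4, 5`. [cite: BorceaBrandenLiggett2007, §7 Counterexample 1 (`c_k`, (7.1))] -/
theorem rankSeq_ceWeight_values :
    rankSeq ceWeight 3 = 171 * (4 / 9 - 1 / 10000) + 969 * (1 / 19) ∧
      rankSeq ceWeight 4 = 969 * (2 / 3) + 3876 * (3 / 19) ∧
      rankSeq ceWeight 5 = 3876 * 1 + 11628 * ((9 - 1 / 10000) / 19) := by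
  have h19 : Fintype.card (Fin 19) = 19 := Fintype.card_fin 19
  have c2 : ((19 : ℕ).choose 2 : ℝ) = 171 := by exact_mod_cast (by decide : (19 : ℕ).choose 2 = 171)
  have c3 : ((19 : ℕ).choose 3 : ℝ) = 969 := by exact_mod_cast (by decide : (19 : ℕ).choose 3 = 969)
  have c4 : ((19 : ℕ).choose 4 : ℝ) = 3876 := by exact_mod_cast (by decide : (19 : ℕ).choose 4 = 3876)
  have c5 : ((19 : ℕ).choose 5 : ℝ) = 11628 := by exact_mod_cast (by decide : (19 : ℕ).choose 5 = 11628)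
  refine ⟨?_, ?_, ?_⟩
  · rw [ceWeight, rankSeq_almostExch, h19, if_neg (by norm_num), show (3 : ℕ) - 1 = 2 from rfl, c2, c3,
      ceA_values.2.2.1, ceB'_values.2.2.2.1]
  · rw [ceWeight, rankSeq_almostExch, h19, if_neg (by norm_num), show (4 : ℕ) - 1 = 3 from rfl, c3, c4,
      ceA_values.2.2.2.1, ceB'_values.2.2.2.2.1]
  · rw [ceWeight, rankSeq_almostExch, h19, if_neg (by norm_num), show (5 : ℕ) - 1 = 4 from rfl, c4, c5,
      ceA_values.2.2.2.2.1, ceB'_values.2.2.2.2.2.1]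

/-- The total mass `Σ_k r_k` is positive. [cite: BorceaBrandenLiggett2007, §7 Counterexample 1] -/
theorem mass_ceWeight_pos : 0 < mass ceWeight := by
  have h1 : rankSeq ceWeight 4 ≤ mass ceWeight := by
    rw [← mass_truncW_self, mass, mass]
    exact Finset.sum_le_sum fun U _ => by rw [truncW_apply]; split_ifs; exacts [le_rfl, ceWeight_nonneg U]
  have h2 : 0 < rankSeq ceWeight 4 := by rw [rankSeq_ceWeight_values.2.1]; norm_num
  exact h2.trans_le h1

/-- **The rank sequence is not ultra log-concave** (at `k = 4`, `d = 20`):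
`(r_3/C(20,3))(r_5/C(20,5)) > (r_4/C(20,4))²`. [cite: BorceaBrandenLiggett2007, §7 Counterexample 1 ("its rank
sequence … is not ULC")] -/
theorem not_isUltraLogConcave_rankSeq_ceWeight : ¬ IsUltraLogConcave 20 (rankSeq ceWeight) := by
  intro h
  have h4 := h 4 (by norm_num) (by norm_num)
  have d3 : ((20 : ℕ).choose 3 : ℝ) = 1140 := by exact_mod_cast (by decide : (20 : ℕ).choose 3 = 1140)
  have d4 : ((20 : ℕ).choose 4 : ℝ) = 4845 := by exact_mod_cast (by decide : (20 : ℕ).choose 4 = 4845)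
  have d5 : ((20 : ℕ).choose 5 : ℝ) = 15504 := by exact_mod_cast (by decide : (20 : ℕ).choose 5 = 15504)
  rw [show (4 : ℕ) - 1 = 3 from rfl, show (4 : ℕ) + 1 = 5 from rfl, d3, d4, d5, rankSeq_ceWeight_values.1,
    rankSeq_ceWeight_values.2.1, rankSeq_ceWeight_values.2.2] at h4
  norm_num at h4

/-- Rayleigh is invariant under positive scaling. [cite: BorceaBrandenLiggett2007, §2.1 Def. 2.5] -/
theorem isRayleigh_smul {σ : Type*} [Fintype σ] [DecidableEq σ] {μ : Finset σ → ℝ} (h : IsRayleigh μ) {c : ℝ}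
    (hc : 0 ≤ c) : IsRayleigh (c • μ) := by
  intro x hx i j
  have key := h x hx i j
  rw [eval_rayleighDiff_multiAffine] at key ⊢
  rw [derivWeight_smul, derivWeight_smul, derivWeight_smul, eval_multiAffine_smul, eval_multiAffine_smul,
    eval_multiAffine_smul, eval_multiAffine_smul]
  have := mul_nonneg (mul_nonneg hc hc) key
  exact this.trans_eq (by ring)

/-- Rank sequences scale. [cite: BorceaBrandenLiggett2007, §2.1 Def. 2.8] -/
theorem rankSeq_smul {σ : Type*} [Fintype σ] (c : ℝ) (μ : Finset σ → ℝ) (k : ℕ) : rankSeq (c • μ) k = c * rankSeq μ k := by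
  rw [rankSeq_def, rankSeq_def, Finset.mul_sum]
  rfl

/-- **Borcea–Brändén–Liggett, §7 Counterexample 1: Conjecture 2.4 ("any Rayleigh measure is ULC") fails** —
there is a Rayleigh probability measure on `2^[20]` whose rank sequence is not ultra log-concave.
[cite: BorceaBrandenLiggett2007, §7 Counterexample 1; §2.1 Conj. 2.4] -/
theorem BorceaBrandenLiggett_counterexample_1 :
    ∃ μ : Finset (Option (Fin 19)) → ℝ,
      (∀ U, 0 ≤ μ U) ∧ mass μ = 1 ∧ IsRayleigh μ ∧ ¬ IsUltraLogConcave 20 (rankSeq μ) := by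
  refine ⟨(mass ceWeight)⁻¹ • ceWeight, fun U => ?_, ?_, isRayleigh_smul isRayleigh_ceWeight
    (inv_nonneg.2 mass_ceWeight_pos.le), fun h => not_isUltraLogConcave_rankSeq_ceWeight fun k hk hkd => ?_⟩
  · rw [Pi.smul_apply, smul_eq_mul]
    exact mul_nonneg (inv_nonneg.2 mass_ceWeight_pos.le) (ceWeight_nonneg U)
  · rw [mass]
    simp only [Pi.smul_apply, smul_eq_mul]
    rw [← Finset.mul_sum, ← mass, inv_mul_cancel₀ mass_ceWeight_pos.ne']
  · have key := h k hk hkd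
    rw [rankSeq_smul, rankSeq_smul, rankSeq_smul] at key
    have hm : 0 < (mass ceWeight)⁻¹ := inv_pos.2 mass_ceWeight_pos
    set c := (mass ceWeight)⁻¹ with hc
    have h2 : c * rankSeq ceWeight (k - 1) / ((20 : ℕ).choose (k - 1) : ℝ) *
        (c * rankSeq ceWeight (k + 1) / ((20 : ℕ).choose (k + 1) : ℝ)) =
        c ^ 2 * (rankSeq ceWeight (k - 1) / ((20 : ℕ).choose (k - 1) : ℝ) *
          (rankSeq ceWeight (k + 1) / ((20 : ℕ).choose (k + 1) : ℝ))) := by ring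
    have h3 : (c * rankSeq ceWeight k / ((20 : ℕ).choose k : ℝ)) ^ 2 =
        c ^ 2 * (rankSeq ceWeight k / ((20 : ℕ).choose k : ℝ)) ^ 2 := by ring
    rw [h2, h3] at key
    exact le_of_mul_le_mul_left key (pow_pos hm 2)

/-- `μ_k(𝒜)` for `𝒜 = {S ∋ z_{20}}`: `E_{μ_k} 𝟙_𝒜 = C(19,k-1) a_{k-1} / r_k`. [cite: BorceaBrandenLiggett2007, §7
Counterexample 2] -/
theorem lawMean_truncMeasure_ceWeight (k : ℕ) (hk : k ≠ 0) :
    lawMean (truncMeasure k k ceWeight) (fun U => if none ∈ U then (1 : ℝ) else 0) =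
      ((19 : ℕ).choose (k - 1) : ℝ) * ceA (k - 1) / rankSeq ceWeight k := by
  rw [lawMean]
  have hterm : ∀ U : Finset (Option (Fin 19)), truncMeasure k k ceWeight U * (if none ∈ U then (1 : ℝ) else 0) =
      (if U.card = k ∧ none ∈ U then almostExch ceA ceB' U else 0) / rankSeq ceWeight k := by
    intro U
    rw [truncMeasure_apply, mass_truncW_self, truncW_apply]
    by_cases h1 : U.card = k <;> by_cases h2 : none ∈ U
    · rw [if_pos (show k ≤ U.card ∧ U.card ≤ k from ⟨h1.ge, h1.le⟩), if_pos h2,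
        if_pos (show U.card = k ∧ none ∈ U from ⟨h1, h2⟩), mul_one]; rfl
    · rw [if_neg h2, mul_zero, if_neg (show ¬(U.card = k ∧ none ∈ U) from fun h => h2 h.2), zero_div]
    · rw [if_neg (show ¬(k ≤ U.card ∧ U.card ≤ k) from fun h => h1 (le_antisymm h.2 h.1)),
        if_neg (show ¬(U.card = k ∧ none ∈ U) from fun h => h1 h.1), zero_div, zero_mul]
    · rw [if_neg h2, mul_zero, if_neg (show ¬(U.card = k ∧ none ∈ U) from fun h => h1 h.1), zero_div]
  simp_rw [hterm]
  have h19 : Fintype.card (Fin 19) = 19 := Fintype.card_fin 19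
  have key := sum_card_none_mem_almostExch (τ := Fin 19) ceA ceB' k
  rw [if_neg hk, h19] at key
  rw [← Finset.sum_div, key]

/-- **Borcea–Brändén–Liggett, §7 Counterexample 2 (Rayleigh version): `μ_3 ⋠ μ_4`** for the Rayleigh measure of
Counterexample 1 — `μ_3(𝒜) > μ_4(𝒜)` for the increasing event `𝒜 = {S ∋ z_{20}}` ("This fails for `k = 3`"), so
the truncation `μ_3` is not stochastically dominated by `μ_4` although `μ` is Rayleigh (= h-NLC+) with
`r_3 r_4 > 0`. [cite: BorceaBrandenLiggett2007, §7 Counterexample 2; §2.4 Def. 2.14–2.15, Problem 2.8, Conj. 2.9] -/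
theorem BorceaBrandenLiggett_counterexample_2 :
    IsRayleigh ceWeight ∧ 0 < rankSeq ceWeight 3 * rankSeq ceWeight 4 ∧
      ¬ StochDom (truncMeasure 3 3 ceWeight) (truncMeasure 4 4 ceWeight) := by
  refine ⟨isRayleigh_ceWeight, by rw [rankSeq_ceWeight_values.1, rankSeq_ceWeight_values.2.1]; norm_num,
    fun h => ?_⟩
  have hmono : Monotone fun U : Finset (Option (Fin 19)) => if none ∈ U then (1 : ℝ) else 0 := by
    intro U V hUV
    dsimp only
    by_cases hU : none ∈ U
    · rw [if_pos hU, if_pos (hUV hU)]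
    · rw [if_neg hU]; split_ifs <;> norm_num
  have key := h _ hmono
  have c2 : ((19 : ℕ).choose 2 : ℝ) = 171 := by exact_mod_cast (by decide : (19 : ℕ).choose 2 = 171)
  have c3 : ((19 : ℕ).choose 3 : ℝ) = 969 := by exact_mod_cast (by decide : (19 : ℕ).choose 3 = 969)
  rw [lawMean_truncMeasure_ceWeight 3 (by norm_num), lawMean_truncMeasure_ceWeight 4 (by norm_num),
    rankSeq_ceWeight_values.1, rankSeq_ceWeight_values.2.1, show (3 : ℕ) - 1 = 2 from rfl,
    show (4 : ℕ) - 1 = 3 from rfl, c2, c3, ceA_values.2.2.1, ceA_values.2.2.2.1] at key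
  norm_num at key

end Counterexample

end Literature.Probability.NegativeDependence

end
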